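import Summits.RiemannHypothesis.RiemannHypothesis.Theorems.PfPersistenceM2EvenSectorIndexComplete
import Summits.RiemannHypothesis.RiemannHypothesis.Theorems.PfPersistenceTwoParityIndexOddLower
import HarnessLib

/-!
# Pf-persistence index route (M2), odd sector at `K = ∞`, part 1/3: odd annihilating test functions

Long-odds MECHANISM SEARCH (cell `pub-rhpf`, seat M2); every result here is RH-free and makes no
claim about RH.  Notation: `𝒵_θ = {ρ : ζ(ρ) = 0 non-trivial, Re ρ ≥ 1/2 + θ, Im ρ > 0}`,
`ĝ = weilMellin g`, (QA_θ) = `QuadrantAnnihilable θ` (even real tests separating each `e ∈ 𝒵_θ`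
from `𝒵_θ ∖ {e}`; an unconditional theorem for every `θ > 0`,
`PfPersistenceM2EvenSectorUnconditional.quadrantAnnihilable_pos`).

The cand-7 seat closed the ODD half of the two-parity index ladder for FINITE `K`
(`PfPersistenceTwoParityIndexOddLower.lean`); the even half is closed for every `K ∈ ℕ ∪ {∞}`.
This three-part packet closes the odd half at `K = ∞`: part 1 (this file) manufactures the ODD
annihilating tests from the even ones, part 2 is the odd negative-definite engine with bystander
control, part 3 the ladder statements.

PROVED here (RH-free):
* `im_weilMellin_eq_zero_of_far_odd` — for an odd real `g`, `Im ĝ = 0` on a set containing `𝒵_θ`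
  transports to every non-trivial zero with `|Re ρ - 1/2| ≥ θ` (values `x, x̄, -x, -x̄` on a
  quadruple; the odd twin of `re_weilMellin_eq_zero_of_far`).
* `exists_evenRealTest_weilMellin_eq_of_annihilable` — under (QA_θ), `θ > 0`: for `e ∈ 𝒵_θ` and ANY
  value `v : ℂ` an even real compactly supported Weil test with `φ̂(e) = v`, `φ̂ = 0` on `𝒵_θ ∖ {e}`
  (phase lemma: a real combination of `φ` and its symmetric translate by `1/γ_e`).
* `exists_oddRealTest_weilMellin_one_of_annihilable` — under (QA_θ), `θ > 0`: an ODD real compactly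
  supported Weil test with `ψ̂(e) = 1`, `ψ̂ = 0` on `𝒵_θ ∖ {e}` (`ψ = φ'` for the even test with value
  `-1/(e - 1/2)`; `(φ')^ = -(s - 1/2) φ̂`, cand-7's recipe).
-/

noncomputable section

open Complex Filter Set MeasureTheory
open scoped Real Topology ComplexConjugate

namespace Summit.RiemannHypothesis.RiemannHypothesis.Theorems.PfPersistenceM2NegIndex

open Literature.NumberTheory.LFunctions
open Literature.NumberTheory.LFunctions.ZetaZeros
open Summit.RiemannHypothesis.RiemannHypothesis.Theorems.RuelleBandExactFirstBand
  (weilMellin_one_sub_of_odd conj_weilMellin_of_real isWeilTest_symTranslate symTranslate_even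
    symTranslate_im weilMellin_symTranslate)

/-! ## A. Transport of `Im ĝ = 0` for odd real tests -/

/-- Localised im-part transport: for an ODD real `g`, if `Im ĝ` vanishes on a set `Z` containing
every non-trivial zero with `Re ρ ≥ 1/2 + θ`, `Im ρ > 0`, then `Im ĝ(ρ) = 0` at every non-trivial
zero with `|Re ρ - 1/2| ≥ θ` (`ĝ` takes the values `x, x̄, -x, -x̄` on `ρ, ρ̄, 1-ρ, 1-ρ̄`).
[cite: Bombieri2000Weil, Thm 9 (odd part)] -/
theorem im_weilMellin_eq_zero_of_far_odd {g : ℝ → ℂ} (hodd : ∀ t : ℝ, g (-t) = -g t)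
    (hreal : ∀ t : ℝ, (g t).im = 0) {θ : ℝ} {Z : Set ℂ}
    (hZ : ∀ ρ ∈ riemannZetaNontrivialZeros, 1 / 2 + θ ≤ ρ.re → 0 < ρ.im → ρ ∈ Z)
    (hvan : ∀ ρ ∈ Z, (weilMellin g ρ).im = 0) {ρ : ℂ} (hρ : ρ ∈ riemannZetaNontrivialZeros)
    (hfar : θ ≤ |ρ.re - 1 / 2|) : (weilMellin g ρ).im = 0 := by
  have him : ρ.im ≠ 0 := riemannZetaNontrivialZeros.im_ne_zero hρ
  rcases le_abs'.1 hfar with hlt | hgt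
  · rcases lt_or_gt_of_ne him with hneg | hpos
    · have hmem : 1 - ρ ∈ riemannZetaNontrivialZeros := by
        simpa using riemannZetaNontrivialZeros.one_sub_conj_mem (riemannZetaNontrivialZeros.conj_mem hρ)
      have h1 := hvan _ (hZ _ hmem (by simp only [Complex.sub_re, Complex.one_re]; linarith)
        (by simp only [Complex.sub_im, Complex.one_im]; linarith))
      rw [weilMellin_one_sub_of_odd hodd, Complex.neg_im] at h1
      linarith
    · have hmem := riemannZetaNontrivialZeros.one_sub_conj_mem hρ
      have h1 := hvan _ (hZ _ hmem
        (by simp only [Complex.sub_re, Complex.one_re, Complex.conj_re]; linarith)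
        (by simp only [Complex.sub_im, Complex.one_im, Complex.conj_im]; linarith))
      rw [weilMellin_one_sub_of_odd hodd, ← conj_weilMellin_of_real hreal, Complex.neg_im,
        Complex.conj_im] at h1
      linarith
  · rcases lt_or_gt_of_ne him with hneg | hpos
    · have hmem := riemannZetaNontrivialZeros.conj_mem hρ
      have h1 := hvan _ (hZ _ hmem (by simp only [Complex.conj_re]; linarith)
        (by simp only [Complex.conj_im]; linarith))
      rw [← conj_weilMellin_of_real hreal, Complex.conj_im] at h1
      linarith
    · exact hvan _ (hZ _ hρ (by linarith) hpos)

/-! ## B. Even tests with an arbitrary value, odd tests with value `1` -/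

/-- Under (QA_θ) (`θ > 0`): for `e ∈ 𝒵_θ` and ANY `v : ℂ` there is an even, real-valued, compactly
supported Weil test with `φ̂(e) = v` and `φ̂ = 0` on `𝒵_θ ∖ {e}` — a real combination `a φ + b ψ` of
the annihilating test `φ` (`φ̂(e) = i`) and its symmetric translate `ψ` by `1/γ_e`, whose factor at
`e` has non-zero imaginary part (`im_coshFactor`). [folklore] -/
theorem exists_evenRealTest_weilMellin_eq_of_annihilable {θ : ℝ} (hθ : 0 < θ)
    (hann : QuadrantAnnihilable θ) {e : ℂ}
    (he : e ∈ {ρ : ℂ | ρ ∈ riemannZetaNontrivialZeros ∧ 1 / 2 + θ ≤ ρ.re ∧ 0 < ρ.im}) (v : ℂ) :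
    ∃ φ : ℝ → ℂ, ∃ b : ℝ, IsWeilTest φ ∧ (∀ t : ℝ, φ (-t) = φ t) ∧ (∀ t : ℝ, (φ t).im = 0) ∧
      tsupport φ ⊆ Icc (-b) b ∧ weilMellin φ e = v ∧
      ∀ ρ ∈ {ρ : ℂ | ρ ∈ riemannZetaNontrivialZeros ∧ 1 / 2 + θ ≤ ρ.re ∧ 0 < ρ.im}, ρ ≠ e →
        weilMellin φ ρ = 0 := by
  obtain ⟨φ, b, hφt, hφe, hφr, hφs, hφI, hφ0⟩ := hann e he
  have hγ : 0 < e.im := he.2.2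
  have hδ : 0 < e.re - 1 / 2 := by linarith [he.2.1]
  set T : ℝ := 1 / e.im with hTdef
  have hTpos : 0 < T := by simp only [hTdef]; positivity
  set ψ : ℝ → ℂ := fun t ↦ (φ (t - T) + φ (t + T)) / 2 with hψdef
  have hψt : IsWeilTest ψ := isWeilTest_symTranslate hφt T
  have hψe : ∀ t : ℝ, ψ (-t) = ψ t := fun t ↦ symTranslate_even hφe T t
  have hψr : ∀ t : ℝ, (ψ t).im = 0 := fun t ↦ symTranslate_im hφr T t
  have hψs : tsupport ψ ⊆ Icc (-(b + T)) (b + T) := tsupport_symTranslate_subset hφs hTpos.le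
  have hψm : ∀ s : ℂ, weilMellin ψ s =
      weilMellin φ s * ((cexp ((s - 1 / 2) * T) + cexp (-((s - 1 / 2) * T))) / 2) :=
    fun s ↦ weilMellin_symTranslate hφt T s
  set ch : ℂ := (cexp ((e - 1 / 2) * T) + cexp (-((e - 1 / 2) * T))) / 2 with hchdef
  have hchim : 0 < ch.im := by
    rw [hchdef, im_coshFactor]
    have h1 : e.im * T = 1 := by rw [hTdef]; field_simp
    rw [h1]
    exact mul_pos (Real.sinh_pos_iff.2 (mul_pos hδ hTpos))
      (Real.sin_pos_of_pos_of_lt_pi one_pos (by linarith [Real.pi_gt_three]))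
  -- real `a`, `b'` with `(a + b' ch) i = v`
  set w : ℂ := v / I with hwdef
  set b' : ℝ := w.im / ch.im with hb'def
  set a : ℝ := w.re - b' * ch.re with hadef
  have hab : (a : ℂ) + (b' : ℂ) * ch = w := by
    apply Complex.ext
    · simp [hadef, Complex.mul_re]
    · simp only [Complex.add_im, Complex.ofReal_im, Complex.mul_im, Complex.ofReal_re, zero_mul,
        add_zero, zero_add, hb'def]
      exact div_mul_cancel₀ _ hchim.ne'
  have h1t : IsWeilTest fun t ↦ (a : ℂ) * φ t := hφt.const_mul a
  have h2t : IsWeilTest fun t ↦ (b' : ℂ) * ψ t := hψt.const_mul b'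
  set χ : ℝ → ℂ := (fun t ↦ (a : ℂ) * φ t) + fun t ↦ (b' : ℂ) * ψ t with hχdef
  have hχm : ∀ s : ℂ, weilMellin χ s = (a : ℂ) * weilMellin φ s + (b' : ℂ) * weilMellin ψ s :=
    fun s ↦ by
      rw [hχdef, weilMellin_add h1t.1.continuous h1t.2 h2t.1.continuous h2t.2, weilMellin_const_mul,
        weilMellin_const_mul]
  refine ⟨χ, b + T, h1t.add h2t, fun t ↦ ?_, fun t ↦ ?_, ?_, ?_, fun ρ hρ hne ↦ ?_⟩
  · show (a : ℂ) * φ (-t) + (b' : ℂ) * ψ (-t) = (a : ℂ) * φ t + (b' : ℂ) * ψ t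
    rw [hφe, hψe]
  · show ((a : ℂ) * φ t + (b' : ℂ) * ψ t).im = 0
    simp [Complex.mul_im, hφr t, hψr t]
  · have hsub : tsupport χ ⊆ tsupport (fun t ↦ (a : ℂ) * φ t) ∪ tsupport (fun t ↦ (b' : ℂ) * ψ t) :=
      tsupport_add _ _
    refine hsub.trans (union_subset
      (tsupport_mul_subset_right.trans (hφs.trans (Icc_subset_Icc ?_ ?_)))
      (tsupport_mul_subset_right.trans hψs)) <;> linarith
  · rw [hχm, hψm e, ← hchdef, hφI]
    calc (a : ℂ) * I + (b' : ℂ) * (I * ch) = ((a : ℂ) + (b' : ℂ) * ch) * I := by ring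
      _ = v := by rw [hab, hwdef, div_mul_cancel₀ _ I_ne_zero]
  · rw [hχm, hψm ρ, hφ0 ρ hρ hne, zero_mul, mul_zero, mul_zero, add_zero]

/-- **Odd annihilating tests.**  Under (QA_θ) (`θ > 0`): for every `e ∈ 𝒵_θ` there is an ODD,
real-valued, compactly supported Weil test `ψ` with `ψ̂(e) = 1` and `ψ̂ = 0` on `𝒵_θ ∖ {e}`:
`ψ = φ'` for the even test of `exists_evenRealTest_weilMellin_eq_of_annihilable` with value
`-1/(e - 1/2)` (`(φ')^(s) = -(s - 1/2) φ̂(s)`, `weilMellin_deriv`). [folklore] -/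
theorem exists_oddRealTest_weilMellin_one_of_annihilable {θ : ℝ} (hθ : 0 < θ)
    (hann : QuadrantAnnihilable θ) {e : ℂ}
    (he : e ∈ {ρ : ℂ | ρ ∈ riemannZetaNontrivialZeros ∧ 1 / 2 + θ ≤ ρ.re ∧ 0 < ρ.im}) :
    ∃ ψ : ℝ → ℂ, ∃ b : ℝ, IsWeilTest ψ ∧ (∀ t : ℝ, ψ (-t) = -ψ t) ∧ (∀ t : ℝ, (ψ t).im = 0) ∧
      tsupport ψ ⊆ Icc (-b) b ∧ weilMellin ψ e = 1 ∧
      ∀ ρ ∈ {ρ : ℂ | ρ ∈ riemannZetaNontrivialZeros ∧ 1 / 2 + θ ≤ ρ.re ∧ 0 < ρ.im}, ρ ≠ e →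
        weilMellin ψ ρ = 0 := by
  have hne : e - 1 / 2 ≠ 0 := by
    intro h
    have h2 := congrArg Complex.re h
    norm_num [Complex.sub_re] at h2
    linarith [he.2.1]
  obtain ⟨φ, b, hφt, hφe, hφr, hφs, hφv, hφ0⟩ :=
    exists_evenRealTest_weilMellin_eq_of_annihilable hθ hann he (-1 / (e - 1 / 2))
  refine ⟨deriv φ, b, hφt.deriv, PfPersistenceParityIndex.deriv_neg_of_even hφe,
    PfPersistenceParityIndex.im_deriv_eq_zero_of_real (hφt.1.differentiable (by simp)) hφr,
    tsupport_deriv_subset.trans hφs, ?_, fun ρ hρ hρe ↦ ?_⟩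
  · rw [weilMellin_deriv hφt, hφv]
    calc -(e - 1 / 2) * (-1 / (e - 1 / 2)) = (e - 1 / 2) / (e - 1 / 2) := by ring
      _ = 1 := div_self hne
  · rw [weilMellin_deriv hφt, hφ0 ρ hρ hρe, mul_zero]

/-- The odd annihilating tests packaged as Mellin values `ψ̂ᵢ = [ρ = e]` on `𝒵_θ` (the form the
engine of part 2 consumes). [folklore] -/
theorem exists_oddRealTest_indicator_of_annihilable {θ : ℝ} (hθ : 0 < θ)
    (hann : QuadrantAnnihilable θ) {e : ℂ}
    (he : e ∈ {ρ : ℂ | ρ ∈ riemannZetaNontrivialZeros ∧ 1 / 2 + θ ≤ ρ.re ∧ 0 < ρ.im}) :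
    ∃ ψ : ℝ → ℂ, ∃ b : ℝ, IsWeilTest ψ ∧ (∀ t : ℝ, ψ (-t) = -ψ t) ∧ (∀ t : ℝ, (ψ t).im = 0) ∧
      tsupport ψ ⊆ Icc (-b) b ∧
      ∀ ρ ∈ riemannZetaNontrivialZeros, 1 / 2 + θ ≤ ρ.re → 0 < ρ.im →
        weilMellin ψ ρ = if ρ = e then 1 else 0 := by
  classical
  obtain ⟨ψ, b, hψt, hψo, hψr, hψs, hψ1, hψ0⟩ :=
    exists_oddRealTest_weilMellin_one_of_annihilable hθ hann he
  refine ⟨ψ, b, hψt, hψo, hψr, hψs, fun ρ hρ h1 h2 ↦ ?_⟩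
  split_ifs with h
  · rw [h, hψ1]
  · exact hψ0 ρ ⟨hρ, h1, h2⟩ h

end Summit.RiemannHypothesis.RiemannHypothesis.Theorems.PfPersistenceM2NegIndex

end
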